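import Literature.NumberTheory.EllipticCurves.TakahashiDegreeFormulaFromDictionaryProofs
import Literature.NumberTheory.EllipticCurves.HeckeTnGamma0
import Literature.NumberTheory.Automorphic.BrandtHeckeFamily
import HarnessLib

/-!
# Eichler's basis theorem (Pizer 1980, Thm. 2.28) and `takahashi2001_brandtEigenLattice_rank_one`
# from the trace identity (Pizer 1980, Thm. 2.25 (2.8); Eichler 1955 (5); Hijikata–Saito 1973)

Topic `Literature/NumberTheory/EllipticCurves`; theorems only (no definition of a named fact;
D-0026).  A. Pizer, *An algorithm for computing modular forms on `Γ₀(N)`*, J. Algebra 64 (1980),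
proves his Thm. 2.28 — for `p` prime, `p ∤ M`, `O` an Eichler order of level `M` in the
quaternion algebra ramified at `p` and `∞`: `⟨θ₁⟩ ⊕ ⋯ ⊕ ⟨θ_{H-1}⟩ ⊕ 2 S₂(M) ≅ S₂(pM)` as modules
for the Hecke algebra generated by the `T(n)`, `(n, pM) = 1` (the tree's
`BrandtJL.EichlerPizerIso`) — in two lines (p. 360): *"As `H` is a semisimple ring, we need only
check that the traces of the transformations induced by the `T_k(n)`, `(n, N) = 1` on both sides
are equal … `tr B'₀(n) = tr B₀(n) - b(n) = tr B₀(n) - deg T₁(n)` … Thus (2.8) provides precisely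
the equality of traces that we require."*  Here (2.8) (Thm. 2.25, case `r = 0`, `k = 2`) is the
**trace identity**

  `tr_{S₂(Γ₀(pM))} T(n) = tr B(n; p, M) - σ₁(n) + 2 tr_{S₂(Γ₀(M))} T(n)`,   `(n, pM) = 1`,

"proved by having explicit formulas for the traces of the Hecke operators and the trace of the
Brandt matrix" (Eichler 1955 eq. (5) for square-free `M`; Hijikata–Saito 1973, Lemma 1; Pizer
1976, Thm. 4): the Eichler–Selberg trace formula (the tree's unproved named fact
`HeckeTraceFormulaGL2Level`) against Eichler's trace formula for Brandt matrices.

This file formalises exactly Pizer's two lines, i.e. PROVES, for a Brandt setup `S` of type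
`(M, r)` of the tree (`Brandt.XiSetup M r`: definite quaternion algebra of discriminant `r`,
Eichler order of level `M`; `r` need not be prime here),

* `BrandtJL.nonempty_eichlerPizerIso_of_traceIdentity` — **the trace identity for `S` implies
  the Eichler–Pizer isomorphism** `Nonempty (BrandtJL.EichlerPizerIso S)` (Pizer Thm. 2.28), and
* `BrandtJL.finrank_eigenLattice_eq_one_of_traceIdentity`,
  `takahashi2001_brandtEigenLattice_rank_one_of_traceIdentity` — **the trace identity implies
  multiplicity one of `a(W)` in the Brandt module** (the named fact
  `takahashi2001_brandtEigenLattice_rank_one`, Takahashi 2001 p. 78), directly from the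
  multiplicity count (and, alternatively, through the isomorphism and the earlier reduction
  `takahashi2001_brandtEigenLattice_rank_one_of_eichlerPizerIso`).

The trace identity enters as a HYPOTHESIS stated in the tree's vocabulary — `cuspidalHeckeTrace`
(the left-hand side of `HeckeTraceFormulaGL2Level`), `Brandt.matrix`, `σ₁` — exactly as a named
fact for Pizer's (2.8) would state it:

  `∀ n ≥ 1, (n, Mr) = 1 → cuspidalHeckeTrace (M r) 2 𝟙 n = tr (Brandt.matrix S.O n) - σ₁ n + 2 · cuspidalHeckeTrace M 2 𝟙 n`.

Ingredients (all proved in the tree): the abstract engine `HeckeFamilyTraceMultiplicity`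
(equal traces of two semisimple commuting Hecke families ⇒ equal multiplicities ⇒ intertwining
isomorphism), the Brandt side `BrandtHeckeFamily` (Pizer Prop. 2.22), the modular side
`HeckeTnGamma0` (`T_n` on `S₂(Γ₀(N))`, traces `cuspidalHeckeTrace`), Atkin–Lehner multiplicity
one (`mem_span_of_equiv_of_mem_newSubspace0`, `eq_zero_of_equiv_of_mem_properDivisors`), Hasse
(`lFunction_ne_prime_add_one`), the Eisenstein vector / degree-zero splitting of `ℂ^{Cls O}`.

## References

* [Pizer1980] A. Pizer, J. Algebra 64 (1980) 340–390: Prop. 2.22, Thm. 2.25 (2.8), Remark 2.26,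
  Remark 2.27, Thm. 2.28 and its proof (p. 360).
* [Eichler1973] M. Eichler, LNM 320 (1973), Ch. IV §1 (the basis problem for square-free level).
* [Takahashi2001] S. Takahashi, J. Number Theory 90 (2001), §2 p. 78.
-/

noncomputable section

open scoped BigOperators Matrix MatrixGroups ModularForm ArithmeticFunction.sigma
open CongruenceSubgroup Module Module.End ArithmeticFunction

namespace Literature.NumberTheory.EllipticCurves

open Literature.NumberTheory.Automorphic Literature.NumberTheory.Automorphic.Brandt
open Literature.NumberTheory.Automorphic.HeckeTraceFormulaGL2Level
open Literature.NumberTheory.EllipticCurves.ModularForms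

namespace BrandtJL

/-! ### Generic complements to the abstract engine -/

section Generic

variable {V : Type*} [AddCommGroup V] [Module ℂ V] {N N' : ℕ} {c : ℕ → ℂ} {T : ℕ → Module.End ℂ V}

/-- A Hecke family away from `N` is one away from any multiple `N'` of `N`. [folklore] -/
theorem isHeckeFamily_of_dvd (hNN' : N ∣ N') (h : IsHeckeFamily N c T) : IsHeckeFamily N' c T where
  map_one := h.map_one
  map_mul_of_coprime hmn hN' := h.map_mul_of_coprime hmn (Nat.Coprime.coprime_dvd_right hNN' hN')
  map_prime_pow hq hqN' a := h.map_prime_pow hq (fun hqN => hqN' (dvd_trans hqN hNN')) a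

/-- The inclusion of the primes away from a multiple `N'` of `N` into the primes away from `N`. [folklore] -/
def primesNotDvdOfDvd (hNN' : N ∣ N') (q : PrimesNotDvd N') : PrimesNotDvd N :=
  ⟨q, q.2.1, fun hqN => q.2.2 (dvd_trans hqN hNN')⟩

/-- A semisimple commuting family away from `N` is one away from any multiple `N'` of `N`. [folklore] -/
theorem isSemisimpleFamily_of_dvd (hNN' : N ∣ N') (h : IsSemisimpleFamily N T) : IsSemisimpleFamily N' T where
  comm q q' := h.comm (primesNotDvdOfDvd hNN' q) (primesNotDvdOfDvd hNN' q')
  iSup_eq_top := by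
    refine eq_top_iff.mpr ?_
    rw [← h.iSup_eq_top]
    refine iSup_le fun χ => le_trans ?_ (le_iSup _ (fun q => χ (primesNotDvdOfDvd hNN' q)))
    intro v hv
    rw [mem_eigenChar_iff] at hv ⊢
    exact fun q => hv (primesNotDvdOfDvd hNN' q)

/-- Restricting an operator family to a submodule stable at the primes away from `N` (junk value
`0` where not stable). [folklore] -/
def restrictFamily (T : ℕ → Module.End ℂ V) (p : Submodule ℂ V) (n : ℕ) : Module.End ℂ p :=
  open Classical in
  if h : ∀ v ∈ p, T n v ∈ p then (T n).restrict h else 0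

/-- On a stable index the restricted family is the restriction. [folklore] -/
theorem restrictFamily_of_forall {p : Submodule ℂ V} {n : ℕ} (h : ∀ v ∈ p, T n v ∈ p) :
    restrictFamily T p n = (T n).restrict h := by
  unfold restrictFamily
  rw [dif_pos h]

/-- Coercion formula for the restricted family on a stable index. [folklore] -/
theorem coe_restrictFamily_apply {p : Submodule ℂ V} {n : ℕ} (h : ∀ v ∈ p, T n v ∈ p) (v : p) :
    ((restrictFamily T p n v : p) : V) = T n v := by
  rw [restrictFamily_of_forall h]
  rfl

end Generic

/-! ### The Eisenstein eigenvalue system `σ₁` -/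

section Sigma

/-- `σ₁(q) = q + 1` for a prime `q`. [folklore] -/
theorem sigma_one_prime {q : ℕ} (hq : q.Prime) : ((σ 1 q : ℕ) : ℂ) = (q : ℂ) + 1 := by
  rw [← pow_one q, sigma_one_apply_prime_pow hq]
  push_cast
  simp [Finset.sum_range_succ, add_comm]

/-- `σ₁(q^m) = Σ_{i ≤ m} q^i` in `ℂ`. [folklore] -/
theorem sigma_one_prime_pow_eq_sum {q : ℕ} (hq : q.Prime) (m : ℕ) :
    ((σ 1 (q ^ m) : ℕ) : ℂ) = ∑ i ∈ Finset.range (m + 1), (q : ℂ) ^ i := by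
  rw [sigma_one_apply_prime_pow hq]
  push_cast
  rfl

/-- **The Eisenstein system satisfies the weight-two Hecke recursion**:
`σ₁(q^{a+2}) = σ₁(q) σ₁(q^{a+1}) - q σ₁(q^a)`. [folklore] -/
theorem sigma_one_prime_pow_rec {q : ℕ} (hq : q.Prime) (a : ℕ) :
    ((σ 1 (q ^ (a + 2)) : ℕ) : ℂ) = (σ 1 q : ℕ) * (σ 1 (q ^ (a + 1)) : ℕ) - (q : ℂ) * (σ 1 (q ^ a) : ℕ) := by
  rw [sigma_one_prime_pow_eq_sum hq, sigma_one_prime_pow_eq_sum hq, sigma_one_prime_pow_eq_sum hq,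
    sigma_one_prime hq, Finset.sum_range_succ _ (a + 2), Finset.sum_range_succ _ (a + 1)]
  ring

/-- The scalar family `σ₁` on any module is a Hecke family away from any `N` with `c(q) = q`. [folklore] -/
theorem isHeckeFamily_sigmaOne (V : Type*) [AddCommGroup V] [Module ℂ V] (N : ℕ) :
    IsHeckeFamily N (fun q => (q : ℂ)) (scalarFamily V fun n => ((σ 1 n : ℕ) : ℂ)) := by
  refine isHeckeFamily_scalarFamily (by simp) (fun hmn _ => ?_) (fun hq _ a => sigma_one_prime_pow_rec hq a)
  rw [isMultiplicative_sigma.map_mul_of_coprime hmn, Nat.cast_mul]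

end Sigma

/-! ### Weight two: the modular families with constants `c(q) = q` -/

section WeightTwo

variable (N : ℕ) [NeZero N]

/-- In weight `2` the constants `p^{k-1}` are `p`. [folklore] -/
theorem isHeckeFamily_heckeTnGamma0_two :
    IsHeckeFamily N (fun p => (p : ℂ)) (heckeTnGamma0 N 2) := by
  have h := isHeckeFamily_heckeTnGamma0 N 2
  have hc : (fun p : ℕ => (p : ℂ) ^ ((2 : ℤ) - 1)) = fun p : ℕ => (p : ℂ) := by
    funext p
    rw [show (2 : ℤ) - 1 = 1 by norm_num, zpow_one]
  rwa [hc] at h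

/-- The trace of the scalar family on `ℂ` is the scalar. [folklore] -/
theorem trace_scalarFamily_complex (f : ℕ → ℂ) (n : ℕ) :
    LinearMap.trace ℂ ℂ (scalarFamily ℂ f n) = f n := by
  rw [scalarFamily, map_smul, show (1 : Module.End ℂ ℂ) = LinearMap.id from rfl, LinearMap.trace_id,
    Module.finrank_self, Nat.cast_one, smul_eq_mul, mul_one]

end WeightTwo

/-! ### From a one-dimensional complex eigenspace to a rank-one eigen-lattice -/

section Descent

variable {ι : Type*} [Fintype ι]

/-- **Multiplicity one over `ℂ` ⇒ the eigen-lattice has `ℤ`-rank one** (descent `ℂ → ℚ → ℤ`: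
a non-zero complex eigenvector gives a non-zero integral one, `eigenLattice_ne_bot_of_mem_eigenSpace`,
and two integral eigenvectors proportional over `ℂ` are proportional over `ℤ`,
`exists_int_smul_eq_of_complex`). [folklore] -/
theorem finrank_eigenLattice_eq_one_of_finrank_eigenSpace_eq_one {N : ℕ} {T : ℕ → Matrix ι ι ℤ}
    {lam : ℕ → ℤ} (h : Module.finrank ℂ (eigenSpace ℂ N T lam) = 1) :
    Module.finrank ℤ (eigenLattice N T lam) = 1 := by
  classical
  obtain ⟨v₀, hv₀, hspan⟩ := finrank_eq_one_iff'.mp h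
  have hv₀' : (v₀ : ι → ℂ) ≠ 0 := fun h0 => hv₀ (Subtype.ext h0)
  have hne : eigenLattice N T lam ≠ ⊥ := eigenLattice_ne_bot_of_mem_eigenSpace v₀.2 hv₀'
  have hdep : ∀ v ∈ eigenLattice N T lam, ∀ w ∈ eigenLattice N T lam,
      ∃ c d : ℤ, (c ≠ 0 ∨ d ≠ 0) ∧ c • v = d • w := by
    intro v hv w hw
    have hvJ : (fun i => (v i : ℂ)) ∈ eigenSpace ℂ N T lam := intCast_mem_eigenSpace_iff.mpr hv
    have hwJ : (fun i => (w i : ℂ)) ∈ eigenSpace ℂ N T lam := intCast_mem_eigenSpace_iff.mpr hw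
    obtain ⟨α, hα⟩ := hspan ⟨_, hvJ⟩
    obtain ⟨β, hβ⟩ := hspan ⟨_, hwJ⟩
    have hα' : α • (v₀ : ι → ℂ) = fun i => (v i : ℂ) := by
      have := congrArg Subtype.val hα; simpa using this
    have hβ' : β • (v₀ : ι → ℂ) = fun i => (w i : ℂ) := by
      have := congrArg Subtype.val hβ; simpa using this
    by_cases hα0 : α = 0
    · refine ⟨1, 0, Or.inl one_ne_zero, ?_⟩
      rw [hα0, zero_smul] at hα'
      rw [one_smul, zero_smul]
      funext i
      have := congrFun hα' i
      simp only [Pi.zero_apply] at this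
      exact_mod_cast this.symm
    · have hcoe : (fun i => (w i : ℂ)) = (β / α) • fun i => (v i : ℂ) := by
        rw [← hα', ← hβ', smul_smul, div_mul_cancel₀ β hα0]
      exact exists_int_smul_eq_of_complex hcoe
  obtain ⟨φ, hφ, hLφ⟩ := exists_eigenLattice_eq_span hne hdep
  rw [hLφ, ← (LinearEquiv.toSpanNonzeroSingleton ℤ (ι → ℤ) φ hφ).finrank_eq, Module.finrank_self]

end Descent

/-! ### The multiplicity count from the trace identity -/

section Count

variable {M r : ℕ} [NeZero M] [NeZero (M * r)]

/-- **Pizer's trace comparison ⇒ the multiplicity identity.**  For a Brandt setup `S` of type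
`(M, r)` satisfying the trace identity (2.8) and every eigenvalue system `χ` of the primes
`q ∤ M r`:
`mult_χ(ℂ^{Cls O}) + 2 · mult_χ(S₂(Γ₀(M))) = mult_χ(S₂(Γ₀(M r))) + [χ = (q ↦ q + 1)]`
(equal traces of the product families `ℂ^{Cls O} ⊕ S₂(M)²` and `S₂(Mr) ⊕ ℂ_{σ₁}`,
`finrank_eigenChar_eq_of_trace_eq`). [cite: Pizer1980, Thm. 2.28 (proof)] -/
theorem finrank_eigenChar_brandt_add_two_mul [DecidablePred fun χ : PrimesNotDvd (M * r) → ℂ =>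
      ∀ q : PrimesNotDvd (M * r), χ q = (q : ℂ) + 1]
    (S : XiSetup M r) [Fintype (ClassSet S.O)]
    (hTr : ∀ n : ℕ, 0 < n → n.Coprime (M * r) →
      cuspidalHeckeTrace (M * r) 2 1 n =
        (((Brandt.matrix S.O n).trace : ℤ) : ℂ) - ((σ 1 n : ℕ) : ℂ) + 2 * cuspidalHeckeTrace M 2 1 n)
    (χ : PrimesNotDvd (M * r) → ℂ) :
    Module.finrank ℂ (eigenChar (M * r) S.heckeFamily χ) +
        2 * Module.finrank ℂ (eigenChar (M * r) (heckeTnGamma0 M 2) χ) =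
      Module.finrank ℂ (eigenChar (M * r) (heckeTnGamma0 (M * r) 2) χ) +
        (if ∀ q : PrimesNotDvd (M * r), χ q = (q : ℂ) + 1 then 1 else 0) := by
  classical
  haveI : FiniteDimensional ℂ (CuspForm (Gamma0 M) 2) := finiteDimensional_cuspForm_gamma0 M 2
  haveI : FiniteDimensional ℂ (CuspForm (Gamma0 (M * r)) 2) := finiteDimensional_cuspForm_gamma0 (M * r) 2
  have hMN : M ∣ M * r := dvd_mul_right M r
  set σ₁ : ℕ → ℂ := fun n => ((σ 1 n : ℕ) : ℂ) with hσ₁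
  -- the two product families
  set TA : ℕ → Module.End ℂ ((ClassSet S.O → ℂ) × (CuspForm (Gamma0 M) 2 × CuspForm (Gamma0 M) 2)) :=
    fun n => (S.heckeFamily n).prodMap ((heckeTnGamma0 M 2 n).prodMap (heckeTnGamma0 M 2 n)) with hTA
  set TB : ℕ → Module.End ℂ (CuspForm (Gamma0 (M * r)) 2 × ℂ) :=
    fun n => (heckeTnGamma0 (M * r) 2 n).prodMap (scalarFamily ℂ σ₁ n) with hTB
  have hM2 : IsHeckeFamily (M * r) (fun p => (p : ℂ)) (heckeTnGamma0 M 2) :=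
    isHeckeFamily_of_dvd hMN (isHeckeFamily_heckeTnGamma0_two M)
  have hA : IsHeckeFamily (M * r) (fun p => (p : ℂ)) TA := S.isHeckeFamily.prod (hM2.prod hM2)
  have hB : IsHeckeFamily (M * r) (fun p => (p : ℂ)) TB :=
    (isHeckeFamily_heckeTnGamma0_two (M * r)).prod (isHeckeFamily_sigmaOne ℂ (M * r))
  have hsM : IsSemisimpleFamily (M * r) (heckeTnGamma0 M 2) :=
    isSemisimpleFamily_of_dvd hMN (isSemisimpleFamily_heckeTnGamma0 M 2)
  have hsA : IsSemisimpleFamily (M * r) TA := S.isSemisimpleFamily.prod (hsM.prod hsM)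
  have hsB : IsSemisimpleFamily (M * r) TB :=
    (isSemisimpleFamily_heckeTnGamma0 (M * r) 2).prod (isSemisimpleFamily_scalarFamily σ₁)
  have htr : ∀ n : ℕ, 0 < n → n.Coprime (M * r) → LinearMap.trace ℂ _ (TA n) = LinearMap.trace ℂ _ (TB n) := by
    intro n hn hnN
    rw [hTA, hTB]
    simp only [LinearMap.trace_prodMap', S.trace_heckeFamily, trace_heckeTnGamma0,
      trace_scalarFamily_complex, hTr n hn hnN]
    ring
  have key := finrank_eigenChar_eq_of_trace_eq hA hB hsA hsB htr χ
  rw [hTA, hTB, finrank_eigenChar_prodMap, finrank_eigenChar_prodMap, finrank_eigenChar_prodMap,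
    finrank_eigenChar_scalarFamily_complex] at key
  have hiff : (∀ q : PrimesNotDvd (M * r), χ q = σ₁ q) ↔ ∀ q : PrimesNotDvd (M * r), χ q = (q : ℂ) + 1 := by
    refine forall_congr' fun q => ?_
    rw [hσ₁]
    simp only [sigma_one_prime q.2.1]
  rw [two_mul]
  by_cases hcond : ∀ q : PrimesNotDvd (M * r), χ q = (q : ℂ) + 1
  · rw [if_pos hcond]
    rw [if_pos (hiff.mpr hcond)] at key
    omega
  · rw [if_neg hcond]
    rw [if_neg (fun h => hcond (hiff.mp h))] at key
    omega

/-- **Multiplicity one of `a(W)` in the complex Brandt module from the trace identity.**  For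
`W/ℚ` elliptic with a modular parametrisation datum at level `M r` (`r > 1`; `f = P.f` a newform
of level `M r` with `a_p(f) = a_p(W)`) and a Brandt setup `S` of type `(M, r)` satisfying the trace
identity (2.8): the `a(W)`-eigenspace of the Brandt matrices in `ℂ^{Cls O}` is a line
(multiplicity `1 = dim ℂf + [a(W) = σ₁]·0 - 2·0`: Atkin–Lehner multiplicity one at level `M r`,
no such eigenform at level `M`, and `a_q(W) ≠ q + 1` by Hasse). [cite: Pizer1980, Thm. 2.28 (proof)] -/
theorem finrank_eigenSpace_eq_one_of_traceIdentity (S : XiSetup M r) [Fintype (ClassSet S.O)]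
    (hTr : ∀ n : ℕ, 0 < n → n.Coprime (M * r) →
      cuspidalHeckeTrace (M * r) 2 1 n =
        (((Brandt.matrix S.O n).trace : ℤ) : ℂ) - ((σ 1 n : ℕ) : ℂ) + 2 * cuspidalHeckeTrace M 2 1 n)
    (W : WeierstrassCurve ℚ) [W.IsElliptic] (hr : 1 < r) (P : ModularParametrizationData W (M * r)) :
    Module.finrank ℂ (eigenSpace ℂ (M * r) (Brandt.matrix S.O) fun n => W.LFunction n) = 1 := by
  classical
  set f := P.f with hf_def
  have hf : IsNewform0 f := P.isNewformOf.1
  have hcoef : ∀ n, cuspCoeff f n = (W.LFunction n : ℂ) := P.isNewformOf.2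
  set a : ℕ → ℂ := fun n => ((W.LFunction n : ℤ) : ℂ) with ha
  have hfT : ∀ (p : ℕ) (hp : p.Prime), ¬ p ∣ M * r →
      (haveI : NeZero p := ⟨hp.ne_zero⟩; heckeT (Gamma0 (M * r)) 2 p f) = a p • f := by
    intro p hp _
    rw [heckeT_eq_cuspCoeff_smul hf hp, hcoef]
  have hf0 : f ≠ 0 := hf.ne_zero
  have hfnew : f ∈ newSubspace0 (M * r) 2 := hf.1
  have hMdiv : M ∈ (M * r).properDivisors := by
    rw [Nat.mem_properDivisors]
    exact ⟨dvd_mul_right M r, lt_mul_of_one_lt_right (Nat.pos_of_ne_zero (NeZero.ne M)) hr⟩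
  set χ : PrimesNotDvd (M * r) → ℂ := fun q => a q with hχ
  have key := finrank_eigenChar_brandt_add_two_mul S hTr χ
  -- (1) the Brandt term is the eigenspace
  have h1 : eigenChar (M * r) S.heckeFamily χ = eigenSpace ℂ (M * r) (Brandt.matrix S.O) fun n => W.LFunction n :=
    S.eigenChar_heckeFamily_eq_eigenSpace fun n => W.LFunction n
  -- (2) no form of level `M`
  have h2 : eigenChar (M * r) (heckeTnGamma0 M 2) χ = ⊥ := by
    rw [Submodule.eq_bot_iff]
    intro g hg
    refine eq_zero_of_equiv_of_mem_properDivisors hf0 hfnew hfT M hMdiv g fun p hp hpN => ?_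
    haveI : NeZero p := ⟨hp.ne_zero⟩
    have := mem_eigenChar_iff.mp hg ⟨p, hp, hpN⟩
    rwa [heckeTnGamma0_prime M 2 p hp] at this
  -- (3) at level `M r` the eigenpacket is the line `ℂ f`
  have h3 : eigenChar (M * r) (heckeTnGamma0 (M * r) 2) χ = ℂ ∙ f := by
    apply le_antisymm
    · intro g hg
      refine mem_span_of_equiv_of_mem_newSubspace0 hf0 hfnew hfT g fun p hp hpN => ?_
      haveI : NeZero p := ⟨hp.ne_zero⟩
      have := mem_eigenChar_iff.mp hg ⟨p, hp, hpN⟩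
      rwa [heckeTnGamma0_prime (M * r) 2 p hp] at this
    · rw [Submodule.span_singleton_le_iff_mem, mem_eigenChar_iff]
      intro q
      haveI : NeZero (q : ℕ) := ⟨q.2.1.ne_zero⟩
      rw [heckeTnGamma0_prime (M * r) 2 q q.2.1]
      exact hfT q q.2.1 q.2.2
  -- (4) `a(W)` is not the Eisenstein system
  have h4 : ¬ ∀ q : PrimesNotDvd (M * r), χ q = (q : ℂ) + 1 := by
    intro hall
    have hN : M * r ≠ 0 := NeZero.ne _
    obtain ⟨q, hqgt, hq⟩ := Nat.exists_infinite_primes (M * r + 1)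
    have hqN : ¬ q ∣ M * r := fun h => by
      have := Nat.le_of_dvd (Nat.pos_of_ne_zero hN) h
      omega
    have hne : ((W.LFunction q : ℤ) : ℂ) ≠ (q : ℂ) + 1 := by
      exact_mod_cast W.lFunction_ne_prime_add_one hq
    exact hne (hall ⟨q, hq, hqN⟩)
  rw [h1, h2, h3, finrank_bot, mul_zero, add_zero, finrank_span_singleton hf0, if_neg h4, add_zero] at key
  exact key

/-- **The trace identity (2.8) implies that the `a(W)`-eigen-lattice of the Brandt matrices has
`ℤ`-rank one** (the statement of `takahashi2001_brandtEigenLattice_rank_one` for one curve, one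
level and one setup). [cite: Pizer1980, Thm. 2.28 (proof)] -/
theorem finrank_eigenLattice_eq_one_of_traceIdentity (S : XiSetup M r) [Fintype (ClassSet S.O)]
    (hTr : ∀ n : ℕ, 0 < n → n.Coprime (M * r) →
      cuspidalHeckeTrace (M * r) 2 1 n =
        (((Brandt.matrix S.O n).trace : ℤ) : ℂ) - ((σ 1 n : ℕ) : ℂ) + 2 * cuspidalHeckeTrace M 2 1 n)
    (W : WeierstrassCurve ℚ) [W.IsElliptic] (hr : 1 < r) (P : ModularParametrizationData W (M * r)) :
    Module.finrank ℤ (eigenLattice (M * r) (Brandt.matrix S.O) fun n => W.LFunction n) = 1 :=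
  finrank_eigenLattice_eq_one_of_finrank_eigenSpace_eq_one
    (finrank_eigenSpace_eq_one_of_traceIdentity S hTr W hr P)

end Count

/-! ### The degree-zero part: Eisenstein splitting of `ℂ^{Cls O}` -/

section DegreeZero

variable {M r : ℕ} (S : XiSetup M r) [Fintype (ClassSet S.O)]

/-- The degree-zero part is stable under `T(p)`, `p ∤ M r` prime. [folklore] -/
theorem heckeFamily_mem_degreeZero {p : ℕ} (hp : p.Prime) (hpN : ¬ p ∣ M * r)
    (v : ClassSet S.O → ℂ) (hv : v ∈ degreeZero ℂ (ClassSet S.O)) :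
    S.heckeFamily p v ∈ degreeZero ℂ (ClassSet S.O) :=
  mulVec_mem_degreeZero S hp hpN hv

/-- **The Hecke family of a setup restricted to the degree-zero part** `(ℂ^{Cls O})⁰`
(Pizer's modified Brandt matrices `B'(n)` up to conjugation, (2.6)); at a prime `p ∤ M r` it is
the tree's `BrandtJL.heckeOp S hp hpN`. [cite: Pizer1980, (2.6) and Lemma 2.19] -/
def degreeZeroFamily (n : ℕ) : Module.End ℂ (degreeZero ℂ (ClassSet S.O)) :=
  restrictFamily S.heckeFamily (degreeZero ℂ (ClassSet S.O)) n

/-- Coercion formula at a good prime. [folklore] -/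
theorem coe_degreeZeroFamily_apply {p : ℕ} (hp : p.Prime) (hpN : ¬ p ∣ M * r)
    (v : degreeZero ℂ (ClassSet S.O)) :
    ((degreeZeroFamily S p v : degreeZero ℂ (ClassSet S.O)) : ClassSet S.O → ℂ) = S.heckeFamily p v :=
  coe_restrictFamily_apply (heckeFamily_mem_degreeZero S hp hpN) v

/-- At a good prime the restricted family is `BrandtJL.heckeOp`. [folklore] -/
theorem degreeZeroFamily_eq_heckeOp {p : ℕ} (hp : p.Prime) (hpN : ¬ p ∣ M * r)
    (v : degreeZero ℂ (ClassSet S.O)) : degreeZeroFamily S p v = heckeOp S hp hpN v := by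
  apply Subtype.ext
  rw [coe_degreeZeroFamily_apply S hp hpN, coe_heckeOp, XiSetup.heckeFamily_apply]

/-- A simultaneous eigenspace for a non-Eisenstein system lies in the degree-zero part (column
sums `p + 1`). [folklore] -/
theorem eigenChar_le_degreeZero {χ : PrimesNotDvd (M * r) → ℂ} {q : PrimesNotDvd (M * r)}
    (hχ : χ q ≠ (q : ℂ) + 1) : eigenChar (M * r) S.heckeFamily χ ≤ degreeZero ℂ (ClassSet S.O) := by
  intro v hv
  have hq := mem_eigenChar_iff.mp hv q
  rw [XiSetup.heckeFamily_apply] at hq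
  exact sum_eq_zero_of_mulVec_eq_smul _ (sum_matrix_map_prime_eq S q.2.1 q.2.2) hq hχ

/-- The sum of the coordinates of the Eisenstein vector `u_i = 1/w_i` is non-zero. [folklore] -/
theorem sum_eisensteinVector_ne_zero : ∑ i, ((weight S.O i : ℂ))⁻¹ ≠ 0 := by
  have hre : ∀ i, (0 : ℝ) < (((weight S.O i : ℂ))⁻¹).re := fun i => by
    rw [← Complex.ofReal_natCast, ← Complex.ofReal_inv, Complex.ofReal_re, inv_pos]
    exact_mod_cast S.one_le_weight i
  intro h
  have h' := congrArg Complex.re h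
  rw [Complex.re_sum, Complex.zero_re] at h'
  have hO : IsZOrder S.O := (isEichlerOrder_iff_brandt.mpr S.isEichlerOrder).isZOrder
  have hri := rightIdeals_eq_invertibleRightIdeals_of_isTotallyDefinite S.isTotallyDefinite hO
  have hmem : S.O ∈ rightIdeals S.O := by
    rw [hri]
    exact hO.isInvertibleRightIdeal_self
  haveI : Nonempty (ClassSet S.O) := ⟨Quotient.mk (rightClassSetoid S.O) ⟨S.O, hmem⟩⟩
  have := Finset.sum_pos (fun i _ => hre i) Finset.univ_nonempty
  linarith

/-- The Eisenstein vector is not of degree zero. [folklore] -/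
theorem eisensteinVector_not_mem_degreeZero :
    (fun i => ((weight S.O i : ℂ))⁻¹) ∉ degreeZero ℂ (ClassSet S.O) :=
  fun h => sum_eisensteinVector_ne_zero S (mem_degreeZero_iff.mp h)

/-- **Every vector is a sum of simultaneous eigenvectors that are of degree zero except for the
Eisenstein component**; in particular the degree-zero part is spanned by its intersections with
the simultaneous eigenspaces. [folklore] -/
theorem mem_iSup_eigenChar_inf_degreeZero (v : ClassSet S.O → ℂ) (hv : v ∈ degreeZero ℂ (ClassSet S.O)) :
    v ∈ ⨆ χ, eigenChar (M * r) S.heckeFamily χ ⊓ degreeZero ℂ (ClassSet S.O) := by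
  classical
  set Eis : PrimesNotDvd (M * r) → ℂ := fun q => (q : ℂ) + 1 with hEis
  have htop : v ∈ ⨆ χ, eigenChar (M * r) S.heckeFamily χ := by
    rw [S.isSemisimpleFamily.iSup_eq_top]; trivial
  obtain ⟨c, hc, hsum⟩ := (Submodule.mem_iSup_iff_exists_finsupp _ v).mp htop
  -- the non-Eisenstein components are of degree zero
  have hc0 : ∀ χ, χ ≠ Eis → c χ ∈ degreeZero ℂ (ClassSet S.O) := by
    intro χ hχ
    obtain ⟨q, hq⟩ := Function.ne_iff.mp hχ
    exact eigenChar_le_degreeZero S hq (hc χ)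
  -- hence so is the Eisenstein component
  have hcE : c Eis ∈ degreeZero ℂ (ClassSet S.O) := by
    have hsplit : (c.sum fun _ x => x) = c Eis + ∑ χ ∈ c.support.erase Eis, c χ := by
      rw [Finsupp.sum]
      by_cases hmem : Eis ∈ c.support
      · rw [Finset.add_sum_erase _ _ hmem]
      · rw [Finset.erase_eq_of_notMem hmem, Finsupp.notMem_support_iff.mp hmem, zero_add]
    have : c Eis = v - ∑ χ ∈ c.support.erase Eis, c χ := by
      rw [← hsum, hsplit, add_sub_cancel_right]
    rw [this]
    refine Submodule.sub_mem _ hv (Submodule.sum_mem _ fun χ hχ => hc0 χ (Finset.ne_of_mem_erase hχ))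
  have hall : ∀ χ, c χ ∈ eigenChar (M * r) S.heckeFamily χ ⊓ degreeZero ℂ (ClassSet S.O) := by
    intro χ
    by_cases hχ : χ = Eis
    · subst hχ; exact ⟨hc _, hcE⟩
    · exact ⟨hc χ, hc0 χ hχ⟩
  rw [← hsum, Finsupp.sum]
  exact Submodule.sum_mem _ fun χ _ => Submodule.mem_iSup_of_mem χ (hall χ)

/-- **The restricted family on the degree-zero part is a semisimple commuting family.** [cite: Pizer1980, Prop. 2.22] -/
theorem isSemisimpleFamily_degreeZeroFamily : IsSemisimpleFamily (M * r) (degreeZeroFamily S) where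
  comm q q' := by
    apply LinearMap.ext
    intro v
    apply Subtype.ext
    change ((degreeZeroFamily S q (degreeZeroFamily S q' v) : degreeZero ℂ (ClassSet S.O)) : ClassSet S.O → ℂ) =
      ((degreeZeroFamily S q' (degreeZeroFamily S q v) : degreeZero ℂ (ClassSet S.O)) : ClassSet S.O → ℂ)
    rw [coe_degreeZeroFamily_apply S q.2.1 q.2.2, coe_degreeZeroFamily_apply S q'.2.1 q'.2.2,
      coe_degreeZeroFamily_apply S q'.2.1 q'.2.2, coe_degreeZeroFamily_apply S q.2.1 q.2.2]
    exact LinearMap.congr_fun (S.heckeFamily_comm q.2.1 q'.2.1).eq v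
  iSup_eq_top :=
    iSup_eigenChar_restrict_eq_top (degreeZero ℂ (ClassSet S.O))
      (fun q v => coe_degreeZeroFamily_apply S q.2.1 q.2.2 v) (mem_iSup_eigenChar_inf_degreeZero S)

/-- **Multiplicities in the degree-zero part**: `mult_χ((ℂ^{Cls O})⁰) + [χ = Eis] = mult_χ(ℂ^{Cls O})`
(the Eisenstein vector `u` spans a complement: `V_Eis = (V_Eis ∩ V⁰) ⊕ ℂu`, and `V_χ ⊆ V⁰` for
`χ ≠ Eis`). [cite: Pizer1980, Lemma 2.19] -/
theorem finrank_eigenChar_degreeZeroFamily_add [DecidablePred fun χ : PrimesNotDvd (M * r) → ℂ =>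
      ∀ q : PrimesNotDvd (M * r), χ q = (q : ℂ) + 1] (χ : PrimesNotDvd (M * r) → ℂ) :
    Module.finrank ℂ (eigenChar (M * r) (degreeZeroFamily S) χ) +
        (if ∀ q : PrimesNotDvd (M * r), χ q = (q : ℂ) + 1 then 1 else 0) =
      Module.finrank ℂ (eigenChar (M * r) S.heckeFamily χ) := by
  rw [finrank_eigenChar_restrict (degreeZero ℂ (ClassSet S.O))
    (fun q v => coe_degreeZeroFamily_apply S q.2.1 q.2.2 v) χ]
  set Vχ := eigenChar (M * r) S.heckeFamily χ with hVχ
  set V0 := degreeZero ℂ (ClassSet S.O) with hV0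
  by_cases hE : ∀ q : PrimesNotDvd (M * r), χ q = (q : ℂ) + 1
  · rw [if_pos hE]
    set u : ClassSet S.O → ℂ := fun i => ((weight S.O i : ℂ))⁻¹ with hu
    have huV : u ∈ Vχ := by
      rw [hVχ, mem_eigenChar_iff]
      intro q
      rw [hE q]
      exact S.heckeFamily_eisensteinVector q.2.1 q.2.2
    have hu0 : u ≠ 0 := fun h => eisensteinVector_not_mem_degreeZero S (by rw [← hu, h]; exact Submodule.zero_mem _)
    have hsu : ∑ i, u i ≠ 0 := sum_eisensteinVector_ne_zero S
    -- `Vχ = (Vχ ⊓ V0) ⊔ ℂu`, a disjoint sum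
    have hsup : (Vχ ⊓ V0) ⊔ (ℂ ∙ u) = Vχ := by
      apply le_antisymm
      · exact sup_le inf_le_left ((Submodule.span_singleton_le_iff_mem _ _).mpr huV)
      · intro v hv
        rw [Submodule.mem_sup]
        set t : ℂ := (∑ i, v i) / ∑ i, u i with ht
        refine ⟨v - t • u, ⟨Submodule.sub_mem _ hv (Submodule.smul_mem _ _ huV), ?_⟩, t • u,
          Submodule.mem_span_singleton.mpr ⟨t, rfl⟩, sub_add_cancel v _⟩
        change v - t • u ∈ V0
        rw [hV0, mem_degreeZero_iff]
        simp only [Pi.sub_apply, Pi.smul_apply, smul_eq_mul, Finset.sum_sub_distrib, ← Finset.mul_sum]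
        rw [ht, div_mul_cancel₀ _ hsu, sub_self]
    have hdisj : (Vχ ⊓ V0) ⊓ (ℂ ∙ u) = ⊥ := by
      rw [Submodule.eq_bot_iff]
      rintro x ⟨⟨-, hx0⟩, hxu⟩
      obtain ⟨t, rfl⟩ := Submodule.mem_span_singleton.mp hxu
      have : t * ∑ i, u i = 0 := by
        have h := mem_degreeZero_iff.mp hx0
        simpa only [Pi.smul_apply, smul_eq_mul, ← Finset.mul_sum] using h
      rcases mul_eq_zero.mp this with h | h
      · rw [h, zero_smul]
      · exact absurd h hsu
    have hdim := Submodule.finrank_sup_add_finrank_inf_eq (Vχ ⊓ V0) (ℂ ∙ u)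
    rw [hdisj, finrank_bot, add_zero, hsup, finrank_span_singleton hu0] at hdim
    exact hdim.symm
  · rw [if_neg hE, add_zero]
    push Not at hE
    obtain ⟨q, hq⟩ := hE
    have hle : Vχ ≤ V0 := eigenChar_le_degreeZero S hq
    rw [inf_eq_left.mpr hle]

end DegreeZero

/-! ### Pizer's Theorem 2.28 from the trace identity -/

section Iso

variable {M r : ℕ} [NeZero M] [NeZero (M * r)]

/-- **Eichler's basis theorem in Pizer's Hecke-module form (Pizer 1980, Thm. 2.28, `r = 0`,
`k = 2`) from the trace identity (2.8).**  For a Brandt setup `S` of type `(M, r)` such that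
`tr_{S₂(Γ₀(Mr))} T(n) = tr B(n) - σ₁(n) + 2 tr_{S₂(Γ₀(M))} T(n)` for all `n ≥ 1` prime to
`M r`, there is a `ℂ`-linear isomorphism `(ℂ^{Cls O})⁰ ⊕ S₂(Γ₀(M)) ⊕ S₂(Γ₀(M)) ≃ S₂(Γ₀(M r))`
intertwining `T(p) ⊕ T_p ⊕ T_p` with `T_p` for every prime `p ∤ M r`
(`BrandtJL.EichlerPizerIso S`).  Proof (Pizer p. 360): both sides are semisimple commuting Hecke
families away from `M r` with the same traces (the trace identity, with the Eisenstein line split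
off `ℂ^{Cls O}`), hence with the same multiplicities, hence isomorphic. [cite: Pizer1980, Thm. 2.28] -/
theorem nonempty_eichlerPizerIso_of_traceIdentity (S : XiSetup M r) [Fintype (ClassSet S.O)]
    (hTr : ∀ n : ℕ, 0 < n → n.Coprime (M * r) →
      cuspidalHeckeTrace (M * r) 2 1 n =
        (((Brandt.matrix S.O n).trace : ℤ) : ℂ) - ((σ 1 n : ℕ) : ℂ) + 2 * cuspidalHeckeTrace M 2 1 n) :
    Nonempty (EichlerPizerIso S) := by
  classical
  haveI : FiniteDimensional ℂ (CuspForm (Gamma0 M) 2) := finiteDimensional_cuspForm_gamma0 M 2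
  haveI : FiniteDimensional ℂ (CuspForm (Gamma0 (M * r)) 2) := finiteDimensional_cuspForm_gamma0 (M * r) 2
  have hMN : M ∣ M * r := dvd_mul_right M r
  set TA : ℕ → Module.End ℂ (degreeZero ℂ (ClassSet S.O) × (CuspForm (Gamma0 M) 2 × CuspForm (Gamma0 M) 2)) :=
    fun n => (degreeZeroFamily S n).prodMap ((heckeTnGamma0 M 2 n).prodMap (heckeTnGamma0 M 2 n)) with hTA
  have hsM : IsSemisimpleFamily (M * r) (heckeTnGamma0 M 2) :=
    isSemisimpleFamily_of_dvd hMN (isSemisimpleFamily_heckeTnGamma0 M 2)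
  have hsA : IsSemisimpleFamily (M * r) TA := (isSemisimpleFamily_degreeZeroFamily S).prod (hsM.prod hsM)
  have hsB : IsSemisimpleFamily (M * r) (heckeTnGamma0 (M * r) 2) := isSemisimpleFamily_heckeTnGamma0 (M * r) 2
  have hdim : ∀ χ : PrimesNotDvd (M * r) → ℂ,
      Module.finrank ℂ (eigenChar (M * r) TA χ) =
        Module.finrank ℂ (eigenChar (M * r) (heckeTnGamma0 (M * r) 2) χ) := by
    intro χ
    rw [hTA, finrank_eigenChar_prodMap, finrank_eigenChar_prodMap]
    have h1 := finrank_eigenChar_brandt_add_two_mul S hTr χ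
    have h2 := finrank_eigenChar_degreeZeroFamily_add S χ
    omega
  obtain ⟨e, he⟩ := nonempty_linearEquiv_of_finrank_eigenChar_eq hsA hsB hdim
  refine ⟨⟨e, fun p hp hpN x => ?_⟩⟩
  haveI : NeZero p := ⟨hp.ne_zero⟩
  have key := he ⟨p, hp, hpN⟩ x
  rw [hTA] at key
  simp only [LinearMap.prodMap_apply] at key
  rw [degreeZeroFamily_eq_heckeOp S hp hpN, heckeTnGamma0_prime M 2 p hp,
    heckeTnGamma0_prime (M * r) 2 p hp] at key
  exact key

end Iso

end BrandtJL

open BrandtJL in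
/-- **`takahashi2001_brandtEigenLattice_rank_one` from the trace identity (Pizer 1980 Thm. 2.25
(2.8), `r = 0`, `k = 2`; Eichler 1955 (5); Hijikata–Saito 1973 Lemma 1).**  If for every prime
`r`, every `M` with `M r` square-free and every Brandt setup `S` of type `(M, r)` the trace
identity `tr_{S₂(Γ₀(Mr))} T(n) = tr B(n) - σ₁(n) + 2 tr_{S₂(Γ₀(M))} T(n)` holds for all `n ≥ 1`
prime to `M r` (stated with the tree's `cuspidalHeckeTrace`, the left-hand side of the
Eichler–Selberg trace formula `HeckeTraceFormulaGL2Level`, and `Brandt.matrix`), then the named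
fact `takahashi2001_brandtEigenLattice_rank_one` ("`L_r(J)` is free of rank one", Takahashi 2001
p. 78) holds.  This isolates as the ONLY unproved input an explicit identity between traces —
the comparison of the two classical trace formulas. [cite: Pizer1980, Thm. 2.25 (2.8) and Thm. 2.28] -/
theorem takahashi2001_brandtEigenLattice_rank_one_of_traceIdentity
    (h : ∀ (M r : ℕ) [NeZero M] [NeZero (M * r)], r.Prime → Squarefree (M * r) →
      ∀ (S : XiSetup M r) [Fintype (ClassSet S.O)], ∀ n : ℕ, 0 < n → n.Coprime (M * r) →
        cuspidalHeckeTrace (M * r) 2 1 n =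
          (((Brandt.matrix S.O n).trace : ℤ) : ℂ) - ((σ 1 n : ℕ) : ℂ) + 2 * cuspidalHeckeTrace M 2 1 n) :
    takahashi2001_brandtEigenLattice_rank_one := by
  intro W _ M r _ hr hsq _hN P S _
  haveI : NeZero M := ⟨fun h0 => NeZero.ne (M * r) (by rw [h0, zero_mul])⟩
  exact finrank_eigenLattice_eq_one_of_traceIdentity S (h M r hr hsq S) W hr.one_lt P

open BrandtJL in
/-- The same conclusion through Pizer's Theorem 2.28 itself: the trace identity gives the
Eichler–Pizer isomorphisms (`nonempty_eichlerPizerIso_of_traceIdentity`), and the earlier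
reduction `takahashi2001_brandtEigenLattice_rank_one_of_eichlerPizerIso` applies. [cite: Pizer1980, Thm. 2.28] -/
theorem takahashi2001_brandtEigenLattice_rank_one_of_traceIdentity'
    (h : ∀ (M r : ℕ) [NeZero M] [NeZero (M * r)], r.Prime → Squarefree (M * r) →
      ∀ (S : XiSetup M r) [Fintype (ClassSet S.O)], ∀ n : ℕ, 0 < n → n.Coprime (M * r) →
        cuspidalHeckeTrace (M * r) 2 1 n =
          (((Brandt.matrix S.O n).trace : ℤ) : ℂ) - ((σ 1 n : ℕ) : ℂ) + 2 * cuspidalHeckeTrace M 2 1 n) :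
    takahashi2001_brandtEigenLattice_rank_one :=
  takahashi2001_brandtEigenLattice_rank_one_of_eichlerPizerIso fun M r _ _ hr hsq S _ =>
    nonempty_eichlerPizerIso_of_traceIdentity S (h M r hr hsq S)

end Literature.NumberTheory.EllipticCurves

end
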